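import Summits.ABC.ABC.Theorems.TwistAmplificationSharpModerateLawCuspDispersionDefs

/-!
# Crux `TwistAmplification.SharpModerateLaw` (stmt-ABC-1975), line `deep-moduli-cusp-dispersion`:
twist-aware regimes and the stationary phase at `p = 2, 3` (the lead's reshape after cycle 1)

Companion to `…CuspDispersionDefs.lean` (which stays untouched): the corrected regime predicates `HallRegimeTw`,
`ThickTw`, `ResolvedRegimeTw`, `DeepRegimeTw`, the ingredient `CuspSumBound23`, the reshaped stub statements
`ResolvedRegimeLawTw`, `DeepRegimeLawTw`, `HallRegimeLawTw`, the comparison with the typed regimes (corrected thick laws are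
weaker, corrected Hall law stronger), the corrected cover `regimesTw_cover`, and the reshaped composition
`sharpModerateLaw_of_transfer_of_regimeLawsTw` (registered sub-goal of stmt-ABC-1975). Lead `prover-line-stmt-ABC-1975-c1-0`,
2026-08-16; the finding is worker W3's (evidence `stub-misstated-resolvedRegime.md` on the item).
-/

noncomputable section

namespace Summit.ABC.ABC.Theorems.SharpModerateLaw.CuspDispersion

open scoped BigOperators

/-! ## 1. The finding and the corrected regimes

FINDING (worker W3 of the lead, exact census `Y = 2^27 … 2^41` + paper): the archimedean cut `|u³ − v²| ≶ 1728√Y` is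
not twist-covariant. The `d`-twist `x = (d²u₀, d³v₀)` of a pair `x₀` that is HALL at its own scale `Y₀ = Y/d⁶`
(`|u₀³ − v₀³…|`: `|Δ₀| ≤ √Y₀`) can have `√Y < |Δ(x)| ≤ d³√Y`, so it lies in the typed thick regimes (`ResolvedRegime`,
`DeepRegime`) although it carries no dispersion modulus (46–65 % of the typed resolved regime in the census). The
corrected regimes below apply the cut at every twist scale: `HallRegimeTw` — SOME twist divisor `d` (`d² ∣ u`, `d³ ∣ v`)
has `|u³ − v²| ≤ 1728√Y·d³` (the twist-minimal reduction is Hall at its own scale); `ThickTw` — no such `d`;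
`ResolvedRegimeTw` / `DeepRegimeTw` — `ThickTw` plus the `r'`-threshold. Taking `d = 1`: `HallRegime ⊆ HallRegimeTw`,
hence `ResolvedRegimeTw ⊆ ResolvedRegime`, `DeepRegimeTw ⊆ DeepRegime` (the corrected thick laws are WEAKER than the
typed ones, the corrected Hall law stronger), and the three corrected regimes still cover (`regimesTw_cover`).
Second ingredient recorded here: the complete cusp sums at `p = 2, 3` satisfy the same bound `|S| ≤ 2·p^{n/2}`
(`CuspSumBound23`; numerically max `|S|/p^{n/2} = √2` for `p = 2`, `3 ≤ n ≤ 8`, and `≤ 1.88` for `p = 3`, `n ≤ 6`) — the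
landed `CuspSumBound` is stated for `p ≥ 5` only, while the `2,3`-part of `u³ − v²` carries 61–68 % of the log-depth
`|Δ|/r'` of twist-minimal resolved pairs in the census, so any dispersion argument needs it. -/

/-- Twist-aware HALL regime: some twist divisor `d` (`d² ∣ u`, `d³ ∣ v`) has `|u³ − v²| ≤ 1728·√Y·d³`, i.e. the pair is the
`d`-twist of a pair lying in the Hall tube of its own scale `Y/d⁶`. (`d = 1` is the typed `HallRegime`.) -/
def HallRegimeTw (Y : ℝ) (x : ℤ × ℤ) : Prop :=
  ∃ d : ℕ, (d : ℤ) ^ 2 ∣ x.1 ∧ (d : ℤ) ^ 3 ∣ x.2 ∧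
    ((|x.1 ^ 3 - x.2 ^ 2| : ℤ) : ℝ) ≤ 1728 * Y ^ (1 / 2 : ℝ) * (d : ℝ) ^ 3

/-- Twist-aware THICK tube: for every twist divisor `d` (`d² ∣ u`, `d³ ∣ v`), `|u³ − v²| > 1728·√Y·d³` — the twist-minimal
reduction of the pair is thick at its own scale. -/
def ThickTw (Y : ℝ) (x : ℤ × ℤ) : Prop :=
  ∀ d : ℕ, (d : ℤ) ^ 2 ∣ x.1 → (d : ℤ) ^ 3 ∣ x.2 →
    ¬ (((|x.1 ^ 3 - x.2 ^ 2| : ℤ) : ℝ) ≤ 1728 * Y ^ (1 / 2 : ℝ) * (d : ℝ) ^ 3)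

/-- Twist-aware RESOLVED regime: twist-aware thick tube and `r' ≥ Y^{1/6}`. -/
def ResolvedRegimeTw (Y : ℝ) (x : ℤ × ℤ) : Prop :=
  ThickTw Y x ∧ Y ^ (1 / 6 : ℝ) ≤ (simpleRad x : ℝ)

/-- Twist-aware DEEP regime: twist-aware thick tube and `r' < Y^{1/6}` (the hardest stub's population, corrected). -/
def DeepRegimeTw (Y : ℝ) (x : ℤ × ℤ) : Prop :=
  ThickTw Y x ∧ (simpleRad x : ℝ) < Y ^ (1 / 6 : ℝ)

/-- **Stationary phase for the cusp sums at `p = 2, 3`**: for `p ∈ {2, 3}`, `n ≥ 2` and `(h₁, h₂)` not both divisible by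
`p`, `|S(h₁,h₂;pⁿ)| ≤ 2·p^{n/2}` (same shape as `CuspSumBound`; the constant `2` covers the observed maxima `√2·2^{n/2}` and
`1.88·3^{n/2}`). Registered stub `stub_cuspStationaryPhase23` of the reshaped skeleton. -/
def CuspSumBound23 : Prop :=
  ∀ p n : ℕ, p.Prime → p < 5 → 2 ≤ n → ∀ h₁ h₂ : ℤ, ¬ ((p : ℤ) ∣ h₁ ∧ (p : ℤ) ∣ h₂) →
    ‖cuspSum p n h₁ h₂‖ ≤ 2 * (p : ℝ) ^ ((n : ℝ) / 2)

/-- Statement of the reshaped `stub_resolvedRegime`: both stationary-phase inputs ⇒ the law on the twist-aware resolved regime. -/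
def ResolvedRegimeLawTw : Prop := CuspSumBound → CuspSumBound23 → LawOn ResolvedRegimeTw

/-- Statement of the reshaped `stub_deepRegime` (hardest): both stationary-phase inputs ⇒ the law on the twist-aware deep regime. -/
def DeepRegimeLawTw : Prop := CuspSumBound → CuspSumBound23 → LawOn DeepRegimeTw

/-- Statement of the reshaped `stub_hallRegime`: the law on the twist-aware Hall regime. -/
def HallRegimeLawTw : Prop := LawOn HallRegimeTw

/-- The typed Hall regime is contained in the twist-aware one (`d = 1`). -/
theorem hallRegimeTw_of_hallRegime {Y : ℝ} {x : ℤ × ℤ} (h : HallRegime Y x) : HallRegimeTw Y x :=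
  ⟨1, by simp, by simp, by simpa [HallRegime] using h⟩

/-- The twist-aware thick tube is contained in the typed thick tube (`d = 1`). -/
theorem not_hall_of_thickTw {Y : ℝ} {x : ℤ × ℤ} (h : ThickTw Y x) :
    ¬ (((|x.1 ^ 3 - x.2 ^ 2| : ℤ) : ℝ) ≤ 1728 * Y ^ (1 / 2 : ℝ)) := by
  have h1 := h 1 (by simp) (by simp)
  simpa using h1

/-- `ResolvedRegimeTw ⊆ ResolvedRegime`. -/
theorem resolvedRegime_of_resolvedRegimeTw {Y : ℝ} {x : ℤ × ℤ} (h : ResolvedRegimeTw Y x) : ResolvedRegime Y x :=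
  ⟨not_hall_of_thickTw h.1, h.2⟩

/-- `DeepRegimeTw ⊆ DeepRegime`. -/
theorem deepRegime_of_deepRegimeTw {Y : ℝ} {x : ℤ × ℤ} (h : DeepRegimeTw Y x) : DeepRegime Y x :=
  ⟨not_hall_of_thickTw h.1, h.2⟩

/-- The corrected thick laws are WEAKER than the typed ones: `LawOn ResolvedRegime → LawOn ResolvedRegimeTw`. -/
theorem lawOn_resolvedRegimeTw_of_lawOn_resolvedRegime (h : LawOn ResolvedRegime) : LawOn ResolvedRegimeTw :=
  lawOn_mono (fun _ _ hx => resolvedRegime_of_resolvedRegimeTw hx) h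

/-- `LawOn DeepRegime → LawOn DeepRegimeTw`. -/
theorem lawOn_deepRegimeTw_of_lawOn_deepRegime (h : LawOn DeepRegime) : LawOn DeepRegimeTw :=
  lawOn_mono (fun _ _ hx => deepRegime_of_deepRegimeTw hx) h

/-- The corrected Hall law is STRONGER than the typed one: `LawOn HallRegimeTw → LawOn HallRegime` (so every certificate
proved from `LawOn HallRegime`, e.g. the near-miss count, transfers to the reshaped stub). -/
theorem lawOn_hallRegime_of_lawOn_hallRegimeTw (h : LawOn HallRegimeTw) : LawOn HallRegime :=
  lawOn_mono (fun _ _ hx => hallRegimeTw_of_hallRegime hx) h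

/-- The three twist-aware regimes cover every pair. -/
theorem regimesTw_cover (Y : ℝ) (x : ℤ × ℤ) :
    (ResolvedRegimeTw Y x ∨ DeepRegimeTw Y x) ∨ HallRegimeTw Y x := by
  by_cases hH : HallRegimeTw Y x
  · exact Or.inr hH
  · have hT : ThickTw Y x := by
      intro d hd2 hd3 hle
      exact hH ⟨d, hd2, hd3, hle⟩
    rcases le_or_gt (Y ^ (1 / 6 : ℝ)) (simpleRad x : ℝ) with h6 | h6
    · exact Or.inl (Or.inl ⟨hT, h6⟩)
    · exact Or.inl (Or.inr ⟨hT, h6⟩)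

/-- **C⁺′ from the three twist-aware regime laws** (union bound over the corrected cover). -/
theorem cuspLawD_of_regimesTw (h3 : LawOn ResolvedRegimeTw) (h4 : LawOn DeepRegimeTw) (h5 : LawOn HallRegimeTw) :
    CuspLawD := by
  have h34 : LawOn (fun Y x => ResolvedRegimeTw Y x ∨ DeepRegimeTw Y x) := lawOn_or h3 h4
  have hall : LawOn (fun Y x => (ResolvedRegimeTw Y x ∨ DeepRegimeTw Y x) ∨ HallRegimeTw Y x) := lawOn_or h34 h5
  exact cuspLawD_of_lawOn_true (lawOn_mono (fun Y x _ => regimesTw_cover Y x) hall)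

/-- **The reshaped composition over named statements**: transfer ∧ the three twist-aware regime laws ⊢ the crux. -/
theorem sharpModerateLaw_of_transfer_of_regimeLawsTw :
    TransferD → LawOn ResolvedRegimeTw → LawOn DeepRegimeTw → LawOn HallRegimeTw → Summit.ABC.ABC.Theses.TwistAmplification.SharpModerateLaw :=
  fun h1 h3 h4 h5 => h1 (cuspLawD_of_regimesTw h3 h4 h5)

end Summit.ABC.ABC.Theorems.SharpModerateLaw.CuspDispersion

end
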